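/-
Copyright (c) 2026 the pub-hodgecm-mathlib formalisation cell (harness21).  Prover seat hodgecm-mathlib-K2E1-p11 (g2), Track B ∕ K2-LIT, h413 =
`stmt-HodgeConjecture-24833`, line `K2_E1_TraceFormulaBeta`, campaign «EIS-R7-BL-SPH-3» ∕ R8-LADDER-3, «MS-3» — POLE EXCLUSION AT `N = 2`, LETTER-FREE — the N = 2 twin of deal (132) (dealer K2E1-plan (g7)
2026-09-04T11:31:02Z «then the N = 2 twin off ★ X2b p859696»): ★ X2b `sphericalEisenstein_meromorphic_exports_cm_two` RE-EXPORTED VERBATIM together with the Maass–Selberg bounds (a1)∧(a2)∧(a3) for its constant-term coefficient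
`cI` at every point of every per-ball holomorphy domain `D₁(n) = (D⁺ ∩ D_n ∩ U n) ∖ P` — only the structural measure letters, the idelic∕compact package and `φ₀ ≠ 0` remain.
-/
import Summits.HodgeConjecture.HodgeConjecture.Theorems.K2E1SphericalEisensteinMeromorphicExportsU2Bounds   -- ★ X2b p859696 (K2E1-p13): `sphericalEisenstein_meromorphic_exports_cm_two` ((E1)–(E5), `P`, `cI`, per-ball X1 packages)
import Summits.HodgeConjecture.HodgeConjecture.Theorems.K2E1SphericalEisensteinPoleExclusionCMTwo         -- ★ p859766 (this seat): `poleExclusion_bounds_cm_two` (binder form)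
import HarnessLib

/-!
# h413 ∕ Track B «K2-LIT», «MS-3» — `K2E1SphericalEisensteinPoleExclusionCMThreeFinal`: THE LETTER-FREE POLE-EXCLUSION PACKAGE of the spherical Eisenstein series of `U(2,1)∕CM` —
# ★ X2b₃ (E1)–(E5) ∧ the Maass–Selberg bounds (a1)∧(a2)∧(a3) for `cI` on every `D₁(n) = (D⁺ ∩ D_n ∩ U n) ∖ P`

Cell `pub/hodgecm-mathlib`, crux H413 = `stmt-HodgeConjecture-24833`, route `HCCMUnconditional`; dealer K2E1-plan (g7) deal (132), N = 2 twin (X1∕X2 binders instantiated from ★ p859696, `c := cI` through (E3)).  THEOREMS ONLY (no `def` ∕ `instance` ∕ `notation` ∕ named-fact hypothesis ∕ `sorry`; default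
heartbeats); lane `--kind proof --supports stmt-HodgeConjecture-24833 --as helper` (count-neutral; closes no socket).
WHAT.  For the CM pair `L∕L⁺`, an automorphic `μ`, Haar data `ν_G`, `ν` (with `ν 𝓕 = 1`), the covering weight `β`∕`μZ`, the compact∕idelic package `μK νI 𝓕I` of ★ p859344∕p859607, and `φ₀ ≠ 0`:
the objects `Ec, P, cI, I, η, h, a, κ, T, U, vX, cc` of ★ X2b with ALL its clauses (so that consumers use THIS file's package), AND the new clause (MS): for every ball `n ≥ 2`
(`D_n = ball 0 (n+2)`, weight `n + 3`), `∃ T₀ ≥ 1, ∀ z ∈ D₁(n), (a1)∧(a2)∧(a3)` of ★ p858755 for `c := cI` (base `T₀`, abscissa `Re z − ½`; the brackets `κ_ℝ = ∫_{|x|≤1}∩𝓕I |x|`,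
`m_K = μK(K_U)` as in ★ p859344).  Proof = ★ X2b ∘ ★ `poleExclusion_bounds_cm_two` with `hc` := (E3)'s `AnalyticAt cI` off `P`, `hceq` := (E3)'s tube formula under `ν 𝓕 = 1`,
`hPcount` := co-discreteness (★ `countable_of_codiscrete`), `hn` := `2 ≤ n`.
WHAT IT DOES NOT SAY (dealer (138), no silent gap).  (a1)–(a3) carry the factor `1∕|Im z|`: they bound `cI` uniformly near every NON-REAL `z₀ ∈ P ∩ {½ < Re}` (a punctured neighbourhood
of `z₀` lies in `D₁(n)` since `P ∪ (D_n ∖ U n)` is countable and closed-discrete there), but NOT near REAL points `z₀ ∈ (½, ∞)` and NOT the `(z − 1)`-weighted bound (β) at `z₀ = 1` —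
those are `hMSreal`-type inputs (★ R7-SCALAR pole ledger, (L3), K2E4-p10's ★ p859366 removable-poles bricks).  The `L²`-norm corollary (γ) `‖Fam z‖ ≤ C` near non-real `z₀` needs the
DIAGONAL four-term identity `‖Fam z‖² = R(z,z;cI)` in addition — companion file.
* **`poleExclusion_package_cm_two`** — THE HEAD.
HONEST LABEL.  Count-neutral helper; proves no printed statement; letter-free (structural measure data, the compact∕idelic package, `φ₀ ≠ 0`); HC_CM is proved only modulo the 7 printed
citations (2 remaining named inputs: hLiu418 = `stmt-HodgeConjecture-24832`, h413 = `stmt-HodgeConjecture-24833`) until rung 0 closes.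

## References
* [MoeglinWaldspurger1995] C. Mœglin, J.-L. Waldspurger, *Spectral decomposition and Eisenstein series* (1995), IV.1.8–IV.1.11, IV.2.3, IV.3.12 (a).
* [BernsteinLapid2019] J. Bernstein, E. Lapid, *On the meromorphic continuation of Eisenstein series*, J. AMS 37 (2024), Thm 2.3, §4.
* [Arthur1980TraceFormulaII] J. Arthur, *A trace formula for reductive groups II*, Compositio Math. 40 (1980), §4.
-/

set_option autoImplicit false
-- the mandated namespace repeats `HodgeConjecture.HodgeConjecture`, as in every `Theorems/*.lean` of this sub-problem
set_option linter.dupNamespace false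

noncomputable section

open MeasureTheory Filter Topology Set NumberField
open scoped NNReal ENNReal Classical ComplexConjugate
open Literature.MeasureTheory.Group Literature.NumberTheory Literature.NumberTheory.Automorphic Literature.NumberTheory.Automorphic.UnitaryGroup AdelicGroupData
open Summit.HodgeConjecture.HodgeConjecture.Cruxes.H413.K2E1BorelEisensteinU
open Summit.HodgeConjecture.HodgeConjecture.Cruxes.H413.K2E1BLBorelSpacesU2Defs
open Summit.HodgeConjecture.HodgeConjecture.Cruxes.H413.K2E1BLBorelOperatorsU2Defs
open Summit.HodgeConjecture.HodgeConjecture.Cruxes.H413.K2E1BLEvaluationFunctionalUniformU2 (exists_bound_evalCLM_of_isCompact)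
open Summit.HodgeConjecture.HodgeConjecture.Cruxes.H413.K2E1BLHeckeOperatorWeightedU2 (exists_ciSup_borelHeight_mul_le_of_isCompact)
open Summit.HodgeConjecture.HodgeConjecture.Cruxes.H413.K2E1BLEisensteinMemHXCMTwo (norm_eisensteinSeriesU_flatSectionU_le_uniform_cm_two)
open Summit.HodgeConjecture.HodgeConjecture.Cruxes.H413.K2E1BLLiftIntegrabilityU (quotFun_lift lift_quotientSubgroup_mul)
open Summit.HodgeConjecture.HodgeConjecture.Cruxes.H413.K2E1SphericalHeckeEigenSectionU2 (differentiable_integral_mul_borelHeight_cpow)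
open Summit.HodgeConjecture.HodgeConjecture.Cruxes.H413.K2E1SphericalEisensteinMeromorphicExportsU2Global (sphericalEisenstein_meromorphic_exports_core_cm_two)
open Summit.HodgeConjecture.HodgeConjecture.Cruxes.H413.K2E1SphericalEisensteinMeromorphicExportsU2Bounds (sphericalEisenstein_meromorphic_exports_cm_two)
open Summit.HodgeConjecture.HodgeConjecture.Cruxes.H413.K2E1SphericalEisensteinPoleExclusionCMTwo (poleExclusion_bounds_cm_two)
open Summit.HodgeConjecture.HodgeConjecture.Cruxes.H413.K2E1ConvexDiffCountableConnected (countable_of_codiscrete)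

namespace Summit.HodgeConjecture.HodgeConjecture.Cruxes.H413.K2E1SphericalEisensteinPoleExclusionCMTwoFinal

variable (L : Type) [Field L] [NumberField L] [IsCMField L]
  [MeasurableSpace (quasiSplit (↥(maximalRealSubfield L)) L (IsCMField.complexConj L) 2).Adelic] [BorelSpace (quasiSplit (↥(maximalRealSubfield L)) L (IsCMField.complexConj L) 2).Adelic]
  [MeasurableSpace (AdeleRing (𝓞 L) L)ˣ] [BorelSpace (AdeleRing (𝓞 L) L)ˣ]

/-- **THE LETTER-FREE POLE-EXCLUSION PACKAGE AT `N = 2`** (module docstring): ★ X2b's conclusion verbatim ∧ (MS) `∀ n ≥ 2, ∃ T₀ ≥ 1, ∀ z ∈ D₁(n), (a1)∧(a2)∧(a3)` for `cI`.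
[cite: MoeglinWaldspurger1995, IV.1.8–IV.1.11, IV.3.12 (a)] [cite: BernsteinLapid2019, Thm 2.3, §4] [cite: Arthur1980TraceFormulaII, §4] -/
theorem poleExclusion_package_cm_two
    -- structural letters: the measures (verbatim as FILE X1 ∕ ★ closer₂)
    (μ : Measure (quasiSplit (↥(maximalRealSubfield L)) L (IsCMField.complexConj L) 2).automorphicQuotient) [(quasiSplit (↥(maximalRealSubfield L)) L (IsCMField.complexConj L) 2).IsAutomorphicMeasure μ]
    (νG : Measure (quasiSplit (↥(maximalRealSubfield L)) L (IsCMField.complexConj L) 2).Adelic) [νG.IsHaarMeasure] [νG.IsInvInvariant] [SFinite νG]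
    (ν : Measure ↥(adelicUnipotent (↥(maximalRealSubfield L)) L (IsCMField.complexConj L) 2)) [ν.IsHaarMeasure] [ν.IsMulRightInvariant] [ν.IsInvInvariant]
    {𝓕 : Set ↥(adelicUnipotent (↥(maximalRealSubfield L)) L (IsCMField.complexConj L) 2)}
    (h𝓕N : IsFundamentalDomain ↥(rationalUnipotent (↥(maximalRealSubfield L)) L (IsCMField.complexConj L) 2) 𝓕 ν) (h𝓕c : IsCompact (closure 𝓕)) (h𝓕1 : ν 𝓕 = 1)
    {β : (quasiSplit (↥(maximalRealSubfield L)) L (IsCMField.complexConj L) 2).Adelic → ℝ≥0∞}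
    (hβ : IsCoveringWeight ↥((arithmeticBorel (↥(maximalRealSubfield L)) L (IsCMField.complexConj L) 2).map (quasiSplit (↥(maximalRealSubfield L)) L (IsCMField.complexConj L) 2).arithmeticSubgroup.subtype) β)
    {μZ : Measure (borelQuotient (↥(maximalRealSubfield L)) L (IsCMField.complexConj L) 2)} [SFinite μZ]
    (hμZ : ∀ f : borelQuotient (↥(maximalRealSubfield L)) L (IsCMField.complexConj L) 2 → ℝ≥0∞, Measurable f → ∫⁻ z, f z ∂μZ = ∫⁻ g, β g * f (toBorelQuotient (↥(maximalRealSubfield L)) L (IsCMField.complexConj L) 2 g) ∂νG)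
        -- the compact ∕ idelic package of ★ p859344∕p859607
    (μK : Measure ((standardMaximalCompactGL 2 L).comap (adelicVal (↥(maximalRealSubfield L)) L (IsCMField.complexConj L) 2 ((StdForm.antidiagonal 2).over L)) : Subgroup (quasiSplit (↥(maximalRealSubfield L)) L (IsCMField.complexConj L) 2).Adelic))
    [μK.IsHaarMeasure]
    (νI : Measure (AdeleRing (𝓞 L) L)ˣ) [νI.IsHaarMeasure]
    {𝓕I : Set (AdeleRing (𝓞 L) L)ˣ} (h𝓕I : IsIdeleClassDomain L 𝓕I)
    {φ₀ : ℂ} (hφ₀ : φ₀ ≠ 0) :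
    ∃ (Ec : ℂ → (quasiSplit (↥(maximalRealSubfield L)) L (IsCMField.complexConj L) 2).Adelic → ℂ) (P : Set ℂ) (cI : ℂ → ℂ)
      (I : ℕ → Type) (_ : ∀ n, Fintype (I n)) (η : (n : ℕ) → I n → GL (Fin 2) (AdeleRing (𝓞 L) L) → ℝ) (h : (n : ℕ) → I n → (quasiSplit (↥(maximalRealSubfield L)) L (IsCMField.complexConj L) 2).Adelic → ℂ)
      (a : ℕ → ℝ≥0) (κ : (n : ℕ) → I n → ℝ≥0) (T : (n : ℕ) → I n → HX (↥(maximalRealSubfield L)) L (IsCMField.complexConj L) 2 (n + 3) μ →L[ℂ] HX (↥(maximalRealSubfield L)) L (IsCMField.complexConj L) 2 (n + 3) μ) (U : ℕ → Set ℂ)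
      (vX : (n : ℕ) → ℂ → HX (↥(maximalRealSubfield L)) L (IsCMField.complexConj L) 2 (n + 3) μ) (cc : ℕ → ℂ → ℂ),
      -- GLOBAL: normal-form meromorphy, the Godement agreement, the pole set `P` (closed, co-discrete, inside `{Re ≤ 1}`, off `P` one is in the holomorphy sets)
      (∀ g, MeromorphicNFOn (fun z => Ec z g) univ) ∧ (∀ z : ℂ, 1 < z.re → Ec z = eisensteinSeriesU (flatSectionU (fun _ : (quasiSplit (↥(maximalRealSubfield L)) L (IsCMField.complexConj L) 2).Adelic => φ₀) z)) ∧
      IsClosed P ∧ (∀ z₀ : ℂ, ∀ᶠ s in 𝓝[≠] z₀, s ∉ P) ∧ (∀ z ∈ P, z.re ≤ 1) ∧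
      (∀ z : ℂ, z ∉ P → 1 < z.re ∨ (z ∈ U ⌈‖z‖⌉₊ ∧ z ∈ U (⌈‖z‖⌉₊ + 1))) ∧
      -- (E1) analytic off `P`; (E4) continuous in `g` off `P`; (E2) locally bounded near every `z₀ ∉ P`, uniformly on compacta in `g`
      (∀ g (z : ℂ), z ∉ P → AnalyticAt ℂ (fun z => Ec z g) z) ∧ (∀ z : ℂ, z ∉ P → Continuous (Ec z)) ∧
      (∀ z₀ : ℂ, z₀ ∉ P → ∀ K : Set (quasiSplit (↥(maximalRealSubfield L)) L (IsCMField.complexConj L) 2).Adelic, IsCompact K → ∃ V ∈ 𝓝 z₀, ∃ M : ℝ, ∀ z ∈ V, ∀ g ∈ K, ‖Ec z g‖ ≤ M) ∧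
      -- (E3) the constant-term coefficient `cI`: normal-form meromorphic on `ℂ`, analytic off `P`, `= c` on `{1 < Re}`, and the constant-term link there
      MeromorphicNFOn cI univ ∧ (∀ z : ℂ, z ∉ P → AnalyticAt ℂ cI z) ∧ (∀ z : ℂ, 1 < z.re → cI z = ((((ν 𝓕).toReal⁻¹ : ℝ)) : ℂ) * (∫ v : ↥(adelicUnipotent (↥(maximalRealSubfield L)) L (IsCMField.complexConj L) 2), (((borelHeight ((quasiSplit (↥(maximalRealSubfield L)) L (IsCMField.complexConj L) 2).toAdelic (weylLongU ((IsCMField.complexConj L : L ≃ₐ[↥(maximalRealSubfield L)] L) : L →+* L) (rfl : (StdForm.antidiagonal 2).over L = (StdForm.antidiagonal 2).over L)) * (v : (quasiSplit (↥(maximalRealSubfield L)) L (IsCMField.complexConj L) 2).Adelic)) : ℝ) : ℂ) ^ z) ∂ν)) ∧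
      (∀ z : ℂ, 1 < z.re → ∀ g : (quasiSplit (↥(maximalRealSubfield L)) L (IsCMField.complexConj L) 2).Adelic, borelConstantTerm ν 𝓕 (Ec z) g = φ₀ * (((borelHeight g : ℝ) : ℂ) ^ z + cI z * ((borelHeight g : ℝ) : ℂ) ^ (1 - z))) ∧
      -- PER BALL `D_n = ball 0 (n+2)` (weight `n + 3`): FILE X1's package ((R1), `h = S_η η`, regularity, cover, (R3), (R2), `U n`, `vX n`, `cc n`, Godement, eigen, `α`-system)
      -- and (E5) THE POINTWISE REPRESENTATION of the global `Ec` in X1's integral currency at every `z ∈ U n ∖ P` with `ĥ_j(z) ≠ 0`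
      (∀ n : ℕ,
        (∀ i, IsTestFunctionGL 2 L (η n i) ∧ (∀ g, 0 ≤ η n i g) ∧ (∀ g, η n i g⁻¹ = η n i g) ∧
          ∀ k₁ k₂ : (quasiSplit (↥(maximalRealSubfield L)) L (IsCMField.complexConj L) 2).Adelic, adelicVal (↥(maximalRealSubfield L)) L (IsCMField.complexConj L) 2 ((StdForm.antidiagonal 2).over L) k₁ ∈ standardMaximalCompactGL 2 L → adelicVal (↥(maximalRealSubfield L)) L (IsCMField.complexConj L) 2 ((StdForm.antidiagonal 2).over L) k₂ ∈ standardMaximalCompactGL 2 L →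
              ∀ x, η n i (adelicVal (↥(maximalRealSubfield L)) L (IsCMField.complexConj L) 2 ((StdForm.antidiagonal 2).over L) (k₁ * x * k₂)) = η n i (adelicVal (↥(maximalRealSubfield L)) L (IsCMField.complexConj L) 2 ((StdForm.antidiagonal 2).over L) x)) ∧
        (∀ i, h n i = fun y : (quasiSplit (↥(maximalRealSubfield L)) L (IsCMField.complexConj L) 2).Adelic => orbitalSmoothing νG (fun x : (quasiSplit (↥(maximalRealSubfield L)) L (IsCMField.complexConj L) 2).Adelic => ((η n i (adelicVal (↥(maximalRealSubfield L)) L (IsCMField.complexConj L) 2 ((StdForm.antidiagonal 2).over L) x) : ℝ) : ℂ)) (fun x : (quasiSplit (↥(maximalRealSubfield L)) L (IsCMField.complexConj L) 2).Adelic => ((η n i (adelicVal (↥(maximalRealSubfield L)) L (IsCMField.complexConj L) 2 ((StdForm.antidiagonal 2).over L) x) : ℝ) : ℂ)) y) ∧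
        (∀ i, Continuous (h n i) ∧ HasCompactSupport (h n i) ∧
          (∀ k₀ : (quasiSplit (↥(maximalRealSubfield L)) L (IsCMField.complexConj L) 2).Adelic, adelicVal (↥(maximalRealSubfield L)) L (IsCMField.complexConj L) 2 ((StdForm.antidiagonal 2).over L) k₀ ∈ standardMaximalCompactGL 2 L → ∀ x, h n i (k₀ * x) = h n i x) ∧
          (∀ g, h n i g⁻¹ = h n i g) ∧ (∀ g, conj (h n i g) = h n i g) ∧ (∀ g, 0 ≤ (h n i g).re)) ∧
        (∀ z ∈ Metric.ball (0 : ℂ) (n + 2), ∃ i, (∫ x, h n i x * (((borelHeight x : ℝ≥0) : ℝ) : ℂ) ^ z ∂νG) ≠ 0) ∧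
        0 < a n ∧ (∀ i, 1 ≤ κ n i) ∧
        (∀ i, ∀ z : borelQuotient (↥(maximalRealSubfield L)) L (IsCMField.complexConj L) 2, ∀ y ∈ tsupport (h n i), borelQuotHeight (↥(maximalRealSubfield L)) L (IsCMField.complexConj L) 2 z ≤ κ n i * borelQuotHeight (↥(maximalRealSubfield L)) L (IsCMField.complexConj L) 2 (rightShift (↥(maximalRealSubfield L)) L (IsCMField.complexConj L) 2 y z)) ∧
        (∀ i, ∀ u : HX (↥(maximalRealSubfield L)) L (IsCMField.complexConj L) 2 (n + 3) μ, (T n i u : (quasiSplit (↥(maximalRealSubfield L)) L (IsCMField.complexConj L) 2).automorphicQuotient → ℂ) =ᵐ[(μ.withDensity fun x => (((supHeight (↥(maximalRealSubfield L)) L (IsCMField.complexConj L) 2 x)⁻¹ ^ (2 * (n + 3)) : ℝ≥0) : ℝ≥0∞))]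
            fun ξ => ∫ y, h n i y * (u : (quasiSplit (↥(maximalRealSubfield L)) L (IsCMField.complexConj L) 2).automorphicQuotient → ℂ) (y⁻¹ • ξ) ∂νG) ∧
        IsOpen (U n) ∧ U n ⊆ Metric.ball (0 : ℂ) (n + 2) ∧ Metric.ball (0 : ℂ) (n + 2) ⊆ closure (U n) ∧ (∀ z₀ ∈ Metric.ball (0 : ℂ) (n + 2), ∀ᶠ s in 𝓝[≠] z₀, s ∈ U n) ∧
        DifferentiableOn ℂ (vX n) (U n) ∧ MeromorphicOn (vX n) (Metric.ball (0 : ℂ) (n + 2)) ∧ DifferentiableOn ℂ (cc n) (U n) ∧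
        (∀ z ∈ U n, 1 < z.re → ((vX n z : HX (↥(maximalRealSubfield L)) L (IsCMField.complexConj L) 2 (n + 3) μ) : (quasiSplit (↥(maximalRealSubfield L)) L (IsCMField.complexConj L) 2).automorphicQuotient → ℂ) =ᵐ[(μ.withDensity fun x => (((supHeight (↥(maximalRealSubfield L)) L (IsCMField.complexConj L) 2 x)⁻¹ ^ (2 * (n + 3)) : ℝ≥0) : ℝ≥0∞))] (quasiSplit (↥(maximalRealSubfield L)) L (IsCMField.complexConj L) 2).quotFun (eisensteinSeriesU (flatSectionU (fun _ : (quasiSplit (↥(maximalRealSubfield L)) L (IsCMField.complexConj L) 2).Adelic => φ₀) z))) ∧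
        (∀ z ∈ U n, ∀ i, T n i (vX n z) = (∫ x, h n i x * (((borelHeight x : ℝ≥0) : ℝ) : ℂ) ^ z ∂νG) • vX n z) ∧
        (∃ (hb : IotaBound (↥(maximalRealSubfield L)) L (IsCMField.complexConj L) 2 (n + 3) (a n) μ μZ) (α₁ α₂ : ℂ → HN (↥(maximalRealSubfield L)) L (IsCMField.complexConj L) 2 (n + 3) (a n) μZ),
          (∀ z ∈ Metric.ball (0 : ℂ) (n + 2), (α₁ z : borelQuotient (↥(maximalRealSubfield L)) L (IsCMField.complexConj L) 2 → ℂ) =ᵐ[weightedTruncMeasure (↥(maximalRealSubfield L)) L (IsCMField.complexConj L) 2 (n + 3) (a n) μZ] fun x => (((borelQuotHeight (↥(maximalRealSubfield L)) L (IsCMField.complexConj L) 2 x : ℝ≥0) : ℝ) : ℂ) ^ z) ∧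
          (∀ z ∈ Metric.ball (0 : ℂ) (n + 2), (α₂ z : borelQuotient (↥(maximalRealSubfield L)) L (IsCMField.complexConj L) 2 → ℂ) =ᵐ[weightedTruncMeasure (↥(maximalRealSubfield L)) L (IsCMField.complexConj L) 2 (n + 3) (a n) μZ] fun x => (((borelQuotHeight (↥(maximalRealSubfield L)) L (IsCMField.complexConj L) 2 x : ℝ≥0) : ℝ) : ℂ) ^ (1 - z)) ∧
          (∀ z ∈ Metric.ball (0 : ℂ) (n + 2), α₂ z ≠ 0) ∧
          ∀ z ∈ U n, cnstN (↥(maximalRealSubfield L)) L (IsCMField.complexConj L) 2 (n + 3) (a n) μZ (iota hb (vX n z)) = φ₀ • α₁ z + cc n z • α₂ z) ∧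
        (∀ j, ∀ z ∈ U n, z ∉ P → (∫ x, h n j x * (((borelHeight x : ℝ≥0) : ℝ) : ℂ) ^ z ∂νG) ≠ 0 →
          ∀ g : (quasiSplit (↥(maximalRealSubfield L)) L (IsCMField.complexConj L) 2).Adelic, Ec z g = (∫ x, h n j x * (((borelHeight x : ℝ≥0) : ℝ) : ℂ) ^ z ∂νG)⁻¹ * ∫ y, h n j y * ((vX n z : HX (↥(maximalRealSubfield L)) L (IsCMField.complexConj L) 2 (n + 3) μ) : (quasiSplit (↥(maximalRealSubfield L)) L (IsCMField.complexConj L) 2).automorphicQuotient → ℂ) ((quasiSplit (↥(maximalRealSubfield L)) L (IsCMField.complexConj L) 2).toAutomorphicQuotient (g * y)⁻¹) ∂νG)) ∧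
      -- (MS) POLE EXCLUSION: the Maass–Selberg bounds (a1)∧(a2)∧(a3) for `cI` at EVERY point of `D₁(n) := (D⁺ ∩ D_n ∩ U n) ∖ P`, every ball `n ≥ 2` (★ `poleExclusion_bounds_cm_two`)
      ∀ m : ℕ, 2 ≤ m → ∃ T₀ : ℝ≥0, 1 ≤ T₀ ∧ ∀ z ∈ (({z : ℂ | 1 / 2 < z.re ∧ 0 < z.im} ∩ Metric.ball (0 : ℂ) (m + 2) ∩ U m) \ P),
            Real.sqrt ((∫ x in {x : (AdeleRing (𝓞 L) L)ˣ | (IdeleClassGroup.ideleNorm L x : ℝ) ≤ 1} ∩ 𝓕I, (IdeleClassGroup.ideleNorm L x : ℝ) ∂νI) * μK.real Set.univ * ‖cI z‖ ^ 2 * ‖φ₀‖ ^ 2) ≤ (z.re - 1 / 2) * (T₀ : ℝ) ^ (2 * (z.re - 1 / 2)) * Real.sqrt ((∫ x in {x : (AdeleRing (𝓞 L) L)ˣ | (IdeleClassGroup.ideleNorm L x : ℝ) ≤ 1} ∩ 𝓕I, (IdeleClassGroup.ideleNorm L x : ℝ) ∂νI) * μK.real Set.univ * ‖φ₀‖ ^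 2) / |z.im| +
            Real.sqrt ((z.re - 1 / 2) ^ 2 * (T₀ : ℝ) ^ (4 * (z.re - 1 / 2)) * ((∫ x in {x : (AdeleRing (𝓞 L) L)ˣ | (IdeleClassGroup.ideleNorm L x : ℝ) ≤ 1} ∩ 𝓕I, (IdeleClassGroup.ideleNorm L x : ℝ) ∂νI) * μK.real Set.univ * ‖φ₀‖ ^ 2) / z.im ^ 2 + ((∫ x in {x : (AdeleRing (𝓞 L) L)ˣ | (IdeleClassGroup.ideleNorm L x : ℝ) ≤ 1} ∩ 𝓕I, (IdeleClassGroup.ideleNorm L x : ℝ) ∂νI) * μK.real Set.univ * ‖φ₀‖ ^ 2) * (T₀ : ℝ) ^ (4 * (z.re - 1 / 2))) ∧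
            (∀ {x₁ x₂ η : ℝ}, 0 < x₁ → (z.re - 1 / 2) ∈ Set.Icc x₁ x₂ → 0 < η → η ≤ |z.im| →
            (∫ x in {x : (AdeleRing (𝓞 L) L)ˣ | (IdeleClassGroup.ideleNorm L x : ℝ) ≤ 1} ∩ 𝓕I, (IdeleClassGroup.ideleNorm L x : ℝ) ∂νI) * μK.real Set.univ * ‖cI z‖ ^ 2 * ‖φ₀‖ ^ 2 ≤ (x₂ * (T₀ : ℝ) ^ (2 * x₂) * Real.sqrt ((∫ x in {x : (AdeleRing (𝓞 L) L)ˣ | (IdeleClassGroup.ideleNorm L x : ℝ) ≤ 1} ∩ 𝓕I, (IdeleClassGroup.ideleNorm L x : ℝ) ∂νI) * μK.real Set.univ * ‖φ₀‖ ^ 2) / η + Real.sqrt (x₂ ^ 2 * (T₀ : ℝ) ^ (4 * x₂) * ((∫ x in {x : (AdeleRing (𝓞 L) L)ˣ | (IdeleClassGroup.ideleNorm L x : ℝ) ≤ 1} ∩ 𝓕I, (IdeleClassGroup.ideleNorm L x : ℝ) ∂νI) * μK.real Set.univ * ‖φ₀‖ ^ 2) / η ^ 2 + ((∫ x in {x :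 (AdeleRing (𝓞 L) L)ˣ | (IdeleClassGroup.ideleNorm L x : ℝ) ≤ 1} ∩ 𝓕I, (IdeleClassGroup.ideleNorm L x : ℝ) ∂νI) * μK.real Set.univ * ‖φ₀‖ ^ 2) * (T₀ : ℝ) ^ (4 * x₂))) ^ 2) ∧
            (|z.im| ≤ 1 → (∫ x in {x : (AdeleRing (𝓞 L) L)ˣ | (IdeleClassGroup.ideleNorm L x : ℝ) ≤ 1} ∩ 𝓕I, (IdeleClassGroup.ideleNorm L x : ℝ) ∂νI) * μK.real Set.univ * ‖cI z‖ ^ 2 * ‖φ₀‖ ^ 2 ≤ ((z.re - 1 / 2) * (T₀ : ℝ) ^ (2 * (z.re - 1 / 2)) * Real.sqrt ((∫ x in {x : (AdeleRing (𝓞 L) L)ˣ | (IdeleClassGroup.ideleNorm L x : ℝ) ≤ 1} ∩ 𝓕I, (IdeleClassGroup.ideleNorm L x : ℝ) ∂νI) * μK.real Set.univ * ‖φ₀‖ ^ 2) +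
            Real.sqrt ((z.re - 1 / 2) ^ 2 * (T₀ : ℝ) ^ (4 * (z.re - 1 / 2)) * ((∫ x in {x : (AdeleRing (𝓞 L) L)ˣ | (IdeleClassGroup.ideleNorm L x : ℝ) ≤ 1} ∩ 𝓕I, (IdeleClassGroup.ideleNorm L x : ℝ) ∂νI) * μK.real Set.univ * ‖φ₀‖ ^ 2) + ((∫ x in {x : (AdeleRing (𝓞 L) L)ˣ | (IdeleClassGroup.ideleNorm L x : ℝ) ≤ 1} ∩ 𝓕I, (IdeleClassGroup.ideleNorm L x : ℝ) ∂νI) * μK.real Set.univ * ‖φ₀‖ ^ 2) * (T₀ : ℝ) ^ (4 * (z.re - 1 / 2)))) ^ 2 / z.im ^ 2) := by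
  have h𝓕₀ : ν 𝓕 ≠ 0 := by rw [h𝓕1]; exact one_ne_zero
  obtain ⟨Ec, P, cI, I, hI, η, h, a, κ, T, U, vX, cc, hNF, hEcE, hPc, hPcd, hPre, hPU, hE1, hE4, hE2, hcNF, hcan, hcc, hE3, hballs⟩ :=
    sphericalEisenstein_meromorphic_exports_cm_two L μ νG ν h𝓕N h𝓕c h𝓕₀ hβ hμZ φ₀
  refine ⟨Ec, P, cI, I, hI, η, h, a, κ, T, U, vX, cc, hNF, hEcE, hPc, hPcd, hPre, hPU, hE1, hE4, hE2, hcNF, hcan, hcc, hE3, hballs, fun m hm => ?_⟩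
  obtain ⟨hR1, hdef, hreg, hcov, ha, hκ, hΩ, hTX, hUo, hUD, -, hUcod, hvXd, -, -, -, -, -, hE5⟩ := hballs m
  have hceq : ∀ z : ℂ, 1 < z.re → cI z = (∫ v : ↥(adelicUnipotent (↥(maximalRealSubfield L)) L (IsCMField.complexConj L) 2), (((borelHeight ((quasiSplit (↥(maximalRealSubfield L)) L (IsCMField.complexConj L) 2).toAdelic (weylLongU ((IsCMField.complexConj L : L ≃ₐ[↥(maximalRealSubfield L)] L) : L →+* L) (rfl : (StdForm.antidiagonal 2).over L = (StdForm.antidiagonal 2).over L)) * (v : (quasiSplit (↥(maximalRealSubfield L)) L (IsCMField.complexConj L) 2).Adelic))) : ℝ) : ℂ) ^ z ∂ν) := by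
    intro z hz
    rw [hcc z hz, h𝓕1, ENNReal.toReal_one, inv_one, Complex.ofReal_one, one_mul]
  exact poleExclusion_bounds_cm_two L μ νG μK νI h𝓕I ν h𝓕N h𝓕c h𝓕1 hβ hμZ m (η m) (h m) (a m) (κ m) (T m) (U m) (vX m)
    (fun i => (hR1 i).1) hdef (fun i => ⟨(hreg i).1, (hreg i).2.1⟩) hcov ha hκ hΩ hTX hUo hUD hvXd Ec P hE5 hUcod hm hφ₀ hEcE hPc (countable_of_codiscrete hPcd)
    (fun z hz => (hcan z hz.2).differentiableAt.differentiableWithinAt) hceq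

end Summit.HodgeConjecture.HodgeConjecture.Cruxes.H413.K2E1SphericalEisensteinPoleExclusionCMTwoFinal

end
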